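import Summits.QuantumFields.YangMills.Theorems.AllWindowsColdBoxBoxHighLineOrbitJacobianAssembly
import Summits.QuantumFields.YangMills.Theorems.AllWindowsColdBoxBoxHighLinePauliFarRegion
import Summits.QuantumFields.YangMills.Theorems.AllWindowsColdBoxBoxHighLinePauliRegions

/-!
# T-S5.4J BY NAME (builder ym-line-fcl-p3 g25): `orbitNormaliserJacobianR_of : OrbitMapJacobianDet → OrbitMapContraction → OrbitMapBulkSurj →
# OrbitNormaliserJacobianR` — the window arithmetic over the assembly core (✓`…OrbitJacobianAssembly`) with w5's far-region bricks
# ✓`farRegionPhiLowerBall` (J5a), ✓`fpDetCrude` (J5b), ✓`bulkCutoffOne` (4p) plugged in by name; J1/J2/J4 (w3/w2/w4) enter as hypotheses until they land.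

Constants: `a₀ = 1/((2C₂+1)H²)` (injectivity box, contraction `½`), `a₁ = 1/(2H⁴(1+log β)²)` (inner box, cut-off ≡ 1 by the radius gap),
`ρ₄ = a₁/(C₄(1+log H)²)` (J4 ball); window constant `C = max(…)`, rate `c = 1`.  Target letters: `Cruxes/BoxWindowHighSU2213/TaskS5LaplaceR.lean`
(planner ym-idea-2 g18, amendment (A)); `OrbitNormaliserJacobianR` is declared in ✓`…OrbitJacobianDefs` (appended).

HONEST LABEL: conditional closure of T-S5.4J (modulo J1, J2, J4); S5 (LINE-19 ⟨stmt-QuantumFields-24004⟩/⟨24335⟩), U5 (⟨24336⟩, U5-window OPEN) and the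
items are OPEN; the Yang–Mills mass gap is NOT proved by this file; no summit is proved by a line.
-/

set_option autoImplicit false

noncomputable section

open MeasureTheory Matrix Real Metric Set
open Literature.MathematicalPhysics.QuantumFieldTheory.AxialGauge (boxEdges)
open Literature.MathematicalPhysics.QuantumLattice (gaugeTransformZd LGConfig)
open Literature.Probability.LatticeModels (Site)

namespace Summit.QuantumFields.YangMills.Theorems.AllWindowsColdBoxBoxHighLine.OrbitJacobian

open LaplaceSandwich

/-! ## §1 Numerics: `n' = (2H−1)⁴`, `Z₀`, and the elementary exponential comparisons -/

/-- `n' = #interiorSites H = (2H − 1)⁴` (as a real number, `H ≥ 1`). [folklore] -/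
theorem card_interiorSites (H : ℕ) (hH : 1 ≤ H) : ((interiorSites H).card : ℝ) = (2 * (H : ℝ) - 1) ^ 4 := by
  unfold interiorSites
  rw [Fintype.card_piFinset, Finset.prod_const, Finset.card_univ, Fintype.card_fin, Int.card_Icc]
  have h : (2 * (H : ℤ) - 1 + 1 - 1).toNat = 2 * H - 1 := by omega
  rw [h]
  have h2 : ((2 * H - 1 : ℕ) : ℝ) = 2 * (H : ℝ) - 1 := by
    rw [Nat.cast_sub (by omega), Nat.cast_mul]; norm_num
  rw [Nat.cast_pow, h2]

/-- `1 ≤ n' ≤ 16 H⁴` for `H ≥ 1`. [folklore] -/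
theorem card_interiorSites_bounds (H : ℕ) (hH : 1 ≤ H) :
    (1 : ℝ) ≤ (interiorSites H).card ∧ ((interiorSites H).card : ℝ) ≤ 16 * (H : ℝ) ^ 4 := by
  have hH' : (1 : ℝ) ≤ H := by exact_mod_cast hH
  rw [card_interiorSites H hH]
  constructor
  · have : (1 : ℝ) ≤ 2 * (H : ℝ) - 1 := by linarith
    calc (1 : ℝ) = 1 ^ 4 := by norm_num
      _ ≤ (2 * (H : ℝ) - 1) ^ 4 := pow_le_pow_left₀ zero_le_one this 4
  · have h0 : 0 ≤ 2 * (H : ℝ) - 1 := by linarith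
    calc (2 * (H : ℝ) - 1) ^ 4 ≤ (2 * (H : ℝ)) ^ 4 := pow_le_pow_left₀ h0 (by linarith) 4
      _ = 16 * (H : ℝ) ^ 4 := by ring

/-- `N = |interiorSites H × Fin 3| = 3 n'`. [folklore] -/
theorem card_prod_eq (H : ℕ) : Fintype.card (↥(interiorSites H) × Fin 3) = 3 * (interiorSites H).card := by
  rw [Fintype.card_prod, Fintype.card_coe, Fintype.card_fin, mul_comm]

/-- `Z₀ = ((2π²)^{n'})⁻¹ · √(π/β)^{3n'}` for `β > 0` (the `rpow` of the task letters unfolded). [folklore] -/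
theorem laplaceZ0_eq (H : ℕ) {β : ℝ} (hβ : 0 < β) :
    laplaceZ0 β H = ((2 * Real.pi ^ 2) ^ (interiorSites H).card)⁻¹ * Real.sqrt (Real.pi / β) ^ (3 * (interiorSites H).card) := by
  unfold laplaceZ0
  rw [inv_pow]
  congr 1
  have hx : 0 ≤ Real.pi / β := (div_pos Real.pi_pos hβ).le
  rw [Real.sqrt_eq_rpow, ← Real.rpow_natCast, ← Real.rpow_mul hx]
  congr 1
  push_cast
  ring

/-- `√(2π/β)^N = √2^N · √(π/β)^N`. [folklore] -/
theorem sqrt_two_pi_div_pow (β : ℝ) (N : ℕ) :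
    Real.sqrt (2 * Real.pi / β) ^ N = Real.sqrt 2 ^ N * Real.sqrt (Real.pi / β) ^ N := by
  rw [← mul_pow, ← Real.sqrt_mul (by norm_num : (0:ℝ) ≤ 2), mul_div_assoc]

/-- `√2 ≤ e^{1/2}`. [folklore] -/
theorem sqrt_two_le_exp_half : Real.sqrt 2 ≤ Real.exp (1/2 : ℝ) := by
  have h1 : Real.sqrt 2 ≤ 3/2 := by
    rw [Real.sqrt_le_left (by norm_num)] ; norm_num
  have h2 : (1/2 : ℝ) + 1 ≤ Real.exp (1/2) := Real.add_one_le_exp _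
  linarith

/-- `2π² ≤ e³`. [folklore] -/
theorem two_pi_sq_le_exp_three : 2 * Real.pi ^ 2 ≤ Real.exp 3 := by
  have hπ : Real.pi < 3.15 := Real.pi_lt_d2
  have h1 : 2 * Real.pi ^ 2 ≤ 19.845 := by nlinarith [Real.pi_pos]
  have h2 : (20 : ℝ) ≤ Real.exp 3 := by
    have he := Real.exp_one_gt_d9
    have h3 : Real.exp 3 = Real.exp 1 ^ 3 := by rw [← Real.exp_nat_mul]; norm_num
    have h4 : (2.7182818283 : ℝ) ^ 3 ≤ Real.exp 1 ^ 3 := pow_le_pow_left₀ (by norm_num) he.le 3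
    rw [h3]; norm_num at h4 ⊢; linarith
  linarith

/-- `log 16 ≤ 3`. [folklore] -/
theorem log_sixteen_le_three : Real.log 16 ≤ 3 := by
  rw [Real.log_le_iff_le_exp (by norm_num)]
  have he := Real.exp_one_gt_d9
  have h3 : Real.exp 3 = Real.exp 1 ^ 3 := by rw [← Real.exp_nat_mul]; norm_num
  have h4 : (2.7182818283 : ℝ) ^ 3 ≤ Real.exp 1 ^ 3 := pow_le_pow_left₀ (by norm_num) he.le 3
  rw [h3]; norm_num at h4 ⊢; linarith

/-! ## §2 The by-name wrapper -/

set_option maxHeartbeats 800000 in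
/-- ★★★ **T-S5.4J, conditional on J1/J2/J4**: `OrbitMapJacobianDet → OrbitMapContraction → OrbitMapBulkSurj → OrbitNormaliserJacobianR`
(J5a ✓`farRegionPhiLowerBall`, J5b ✓`fpDetCrude`, 4p ✓`bulkCutoffOne` plugged in by name). [folklore] -/
theorem orbitNormaliserJacobianR_of (hJ1 : OrbitMapJacobianDet) (hJ2 : OrbitMapContraction) (hJ4 : OrbitMapBulkSurj) :
    OrbitNormaliserJacobianR := by
  obtain ⟨C₂, hC₂, hJ2'⟩ := hJ2
  obtain ⟨C₄, hC₄, hJ4'⟩ := hJ4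
  obtain ⟨c₀, c₅, hc₀, hc₅, hJ5⟩ := farRegionPhiLowerBall
  obtain ⟨C_D, hCD, hDet⟩ := fpDetCrude
  set A₂ : ℝ := 2 * C₂ + 1 with hA₂_def
  have hA₂ : 1 ≤ A₂ := by rw [hA₂_def]; linarith
  set Cfar : ℝ := A₂ ^ 2 * (64 * C_D + 74) / c₅ with hCfar_def
  set Cw : ℝ := max (max (max 1 C₂) (max (2 * C₄) (1 / c₀))) (max (800 * C₄ ^ 2) (max Cfar (Real.exp (A₂ + C₄ + 2)))) with hCw_def
  have hCw1 : 1 ≤ Cw := by simp only [hCw_def, le_max_iff, le_refl, true_or]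
  have hCwC₂ : C₂ ≤ Cw := by simp only [hCw_def, le_max_iff, le_refl, true_or, or_true]
  have hCw2C₄ : 2 * C₄ ≤ Cw := by simp only [hCw_def, le_max_iff, le_refl, true_or, or_true]
  have hCwc₀ : 1 / c₀ ≤ Cw := by simp only [hCw_def, le_max_iff, le_refl, true_or, or_true]
  have hCw800 : 800 * C₄ ^ 2 ≤ Cw := by simp only [hCw_def, le_max_iff, le_refl, true_or, or_true]
  have hCwfar : Cfar ≤ Cw := by simp only [hCw_def, le_max_iff, le_refl, true_or, or_true]
  have hCwexp : Real.exp (A₂ + C₄ + 2) ≤ Cw := by simp only [hCw_def, le_max_iff, le_refl, or_true]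
  have hCw0 : 0 < Cw := lt_of_lt_of_le one_pos hCw1
  refine ⟨Cw, 1, hCw0, one_pos, ?_⟩
  intro H hH β r₀ r hβ2 hwin hr₀ hCr₀ hgap hCr V hV hlinks
  -- basic positivity / logs
  have hβ : 0 < β := by linarith
  have hHr : (1 : ℝ) ≤ H := by exact_mod_cast hH
  have hH0 : (0 : ℝ) < H := by linarith
  set L : ℝ := 1 + Real.log β with hL_def
  have hlogβ : 0 < Real.log β := Real.log_pos (by linarith)
  have hL1 : 1 ≤ L := by rw [hL_def]; linarith
  have hL0 : 0 < L := by linarith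
  have hH12 : (1 : ℝ) ≤ (H : ℝ) ^ 12 := one_le_pow₀ hHr
  have hL8 : (1 : ℝ) ≤ L ^ 8 := one_le_pow₀ hL1
  have hβCw : Cw ≤ β := by
    calc Cw = Cw * 1 * 1 := by ring
      _ ≤ Cw * (H : ℝ) ^ 12 * L ^ 8 := by gcongr
      _ ≤ β := hwin
  have hlogC : A₂ + C₄ + 2 ≤ Real.log β := by
    rw [Real.le_log_iff_exp_le hβ]; exact hCwexp.trans hβCw
  have hLA : A₂ + C₄ + 3 ≤ L := by rw [hL_def]; linarith
  have hHβ : (H : ℝ) ≤ β := by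
    calc (H : ℝ) ≤ (H : ℝ) ^ 12 := le_self_pow₀ hHr (by norm_num)
      _ = 1 * (H : ℝ) ^ 12 * 1 := by ring
      _ ≤ Cw * (H : ℝ) ^ 12 * L ^ 8 := by gcongr
      _ ≤ β := hwin
  have hlogH0 : 0 ≤ Real.log H := Real.log_nonneg hHr
  have hlogH : Real.log H ≤ Real.log β := Real.log_le_log hH0 hHβ
  have hLH1 : 1 ≤ 1 + Real.log (H : ℝ) := by linarith
  have hLH : 1 + Real.log (H : ℝ) ≤ L := by rw [hL_def]; linarith
  obtain ⟨hn1, hn16⟩ := card_interiorSites_bounds H hH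
  set n' : ℝ := ((interiorSites H).card : ℝ) with hn'_def
  have hN : (Fintype.card (↥(interiorSites H) × Fin 3) : ℝ) = 3 * n' := by rw [card_prod_eq]; push_cast; rfl
  -- radii
  set a₀ : ℝ := 1 / (A₂ * (H : ℝ) ^ 2) with ha₀_def
  set a₁ : ℝ := 1 / (2 * (H : ℝ) ^ 4 * L ^ 2) with ha₁_def
  set ρ₄ : ℝ := a₁ / (C₄ * (1 + Real.log (H : ℝ)) ^ 2) with hρ₄_def
  have hH2 : (1 : ℝ) ≤ (H : ℝ) ^ 2 := one_le_pow₀ hHr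
  have hH4 : (1 : ℝ) ≤ (H : ℝ) ^ 4 := one_le_pow₀ hHr
  have ha₀ : 0 < a₀ := by positivity
  have ha₀1 : a₀ ≤ 1 := by
    rw [ha₀_def, div_le_one (by positivity)]; exact one_le_mul_of_one_le_of_one_le hA₂ hH2
  have ha₀π : a₀ < Real.pi := lt_of_le_of_lt ha₀1 (by linarith [Real.pi_gt_three])
  have ha₁ : 0 < a₁ := by positivity
  have ha₁a₀ : a₁ ≤ a₀ := by
    rw [ha₁_def, ha₀_def]
    refine one_div_le_one_div_of_le (by positivity) ?_
    have h1 : A₂ ≤ L := by linarith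
    have h2 : (H : ℝ) ^ 2 ≤ (H : ℝ) ^ 4 := pow_le_pow_right₀ hHr (by norm_num)
    have h3 : L ≤ 2 * L ^ 2 := by
      have := le_self_pow₀ hL1 (two_ne_zero); linarith [sq_nonneg L]
    calc A₂ * (H : ℝ) ^ 2 ≤ L * (H : ℝ) ^ 4 := mul_le_mul h1 h2 (by positivity) hL0.le
      _ ≤ (2 * L ^ 2) * (H : ℝ) ^ 4 := mul_le_mul_of_nonneg_right h3 (by positivity)
      _ = 2 * (H : ℝ) ^ 4 * L ^ 2 := by ring
  have hρ₄ : 0 ≤ ρ₄ := by positivity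
  have hr : 0 < r := by
    have : 0 < 1 / ((H : ℝ) ^ 4 * (1 + Real.log β) ^ 2) := by positivity
    linarith
  have hr₀r : r₀ ≤ r := by
    have : 0 ≤ 1 / ((H : ℝ) ^ 4 * (1 + Real.log β) ^ 2) := by positivity
    linarith
  -- J2 on the box `a₀`
  have hC₂r₀ : C₂ * r₀ * (H : ℝ) ^ 2 ≤ 1 := by
    have : C₂ * r₀ * (H : ℝ) ^ 2 ≤ Cw * r₀ * (H : ℝ) ^ 2 := by gcongr
    linarith
  obtain ⟨hF, hcontr0⟩ := hJ2' H hH r₀ a₀ hr₀ ha₀.le ha₀1 hC₂r₀ V hlinks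
  have hK : (C₂ * (H : ℝ) ^ 2 * a₀) ^ 2 ≤ ((1/2 : NNReal) : ℝ) ^ 2 := by
    have h1 : C₂ * (H : ℝ) ^ 2 * a₀ = C₂ / A₂ := by
      rw [ha₀_def]; field_simp
    have h2 : C₂ / A₂ ≤ 1 / 2 := by
      rw [div_le_iff₀ (by positivity), hA₂_def]; linarith
    have h3 : 0 ≤ C₂ / A₂ := by positivity
    rw [h1]; push_cast
    exact pow_le_pow_left₀ h3 h2 2
  have hcontr : ∀ v : ↥(interiorSites H) × Fin 3 → ℝ, (∀ x, ‖(flatten ↥(interiorSites H)).symm v x‖ ≤ a₀) →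
      ∀ w : ↥(interiorSites H) × Fin 3 → ℝ,
        (w - (fpOperator H V)⁻¹ *ᵥ (fderiv ℝ (orbitMapFlat H V) v w)) ⬝ᵥ (w - (fpOperator H V)⁻¹ *ᵥ (fderiv ℝ (orbitMapFlat H V) v w)) ≤
          ((1/2 : NNReal) : ℝ) ^ 2 * (w ⬝ᵥ w) := by
    intro v hv w
    have h := hcontr0 v (fun x => by rw [vecToField_eq_flatten_symm]; exact hv x) w
    have hww : 0 ≤ w ⬝ᵥ w := Finset.sum_nonneg fun i _ => mul_self_nonneg _
    exact h.trans (mul_le_mul_of_nonneg_right hK hww)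
  -- J4 on the box `a₁` onto the ball `ρ₄`
  have hC₄L : C₄ ≤ L ^ 2 := by
    have h1 : C₄ ≤ L := by linarith
    have h2 : L ≤ L ^ 2 := le_self_pow₀ hL1 two_ne_zero
    linarith
  have hC₄L' : C₄ / L ^ 2 ≤ 1 := by rw [div_le_one (by positivity)]; exact hC₄L
  have hJ4a : C₄ * (r₀ + a₁) * (H : ℝ) ^ 2 ≤ 1 := by
    have h1 : C₄ * r₀ * (H : ℝ) ^ 2 ≤ 1 / 2 := by
      have : 2 * C₄ * r₀ * (H : ℝ) ^ 2 ≤ Cw * r₀ * (H : ℝ) ^ 2 := by gcongr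
      linarith
    have h2 : C₄ * a₁ * (H : ℝ) ^ 2 ≤ 1 / 2 := by
      rw [ha₁_def]
      have : C₄ * (1 / (2 * (H : ℝ) ^ 4 * L ^ 2)) * (H : ℝ) ^ 2 = C₄ / L ^ 2 / (2 * (H : ℝ) ^ 2) := by
        field_simp
      rw [this, div_le_iff₀ (by positivity)]
      linarith
    have : C₄ * (r₀ + a₁) * (H : ℝ) ^ 2 = C₄ * r₀ * (H : ℝ) ^ 2 + C₄ * a₁ * (H : ℝ) ^ 2 := by ring
    linarith
  have hJ4b : C₄ * (H : ℝ) ^ 4 * a₁ ≤ 1 := by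
    rw [ha₁_def]
    have : C₄ * (H : ℝ) ^ 4 * (1 / (2 * (H : ℝ) ^ 4 * L ^ 2)) = C₄ / L ^ 2 / 2 := by field_simp
    rw [this]
    linarith
  have hJ4c : C₄ * (1 + Real.log (H : ℝ)) ^ 2 * ρ₄ ≤ a₁ := by
    have : C₄ * (1 + Real.log (H : ℝ)) ^ 2 * ρ₄ = a₁ := by rw [hρ₄_def]; field_simp
    exact this.le
  have hsurj := hJ4' H hH r₀ a₁ ρ₄ hr₀ ha₁.le hρ₄ hJ4a hJ4b hJ4c V hV hlinks
  -- 4p: cut-off identically one on the box `a₁`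
  have hgap' : r₀ + 2 * a₁ ≤ r := by
    have : 2 * a₁ = 1 / ((H : ℝ) ^ 4 * (1 + Real.log β) ^ 2) := by rw [ha₁_def, hL_def]; field_simp
    linarith
  have hcut : ∀ A : ↥(interiorSites H) → EuclideanSpace ℝ (Fin 3), (∀ x, ‖A x‖ ≤ a₁) →
      ballCutoff H r (gaugeTransformZd (pauliGauge H A) V) = 1 :=
    fun A hA => bulkCutoffOne H r₀ a₁ r hr₀ ha₁.le (ha₁a₀.trans (ha₀π.le)) hr hgap' V A hlinks hA
  -- J5a at radius `r`
  have hrH : r * H ≤ c₀ := by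
    have h1 : r * H ≤ 1 / Cw := by
      rw [le_div_iff₀ hCw0]; linarith [show r * (H : ℝ) * Cw = Cw * r * H by ring]
    have h2 : 1 / Cw ≤ c₀ := by
      rw [div_le_iff₀ hCw0]
      have := (div_le_iff₀ hc₀).1 hCwc₀
      linarith
    exact h1.trans h2
  have hlinksr : ∀ e ∈ boxEdges 4 (2 * H + 1), linkDefect V e ≤ r ^ 2 :=
    fun e he => (hlinks e he).trans (pow_le_pow_left₀ hr₀ hr₀r 2)
  have hfar : ∀ A : ↥(interiorSites H) → EuclideanSpace ℝ (Fin 3),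
      (∀ e ∈ boxEdges 4 (2 * H + 1), linkDefect (gaugeTransformZd (pauliGauge H A) V) e < 4 * r ^ 2) → (∀ x, ‖A x‖ ≤ Real.pi) →
        ∀ x₀, c₅ * ‖A x₀‖ ^ 2 ≤ (H : ℝ) ^ 4 * landauPhi H (gaugeTransformZd (pauliGauge H A) V) :=
    fun A hW hπ x₀ => hJ5 H hH r hr.le hrH V A hlinksr hV hW hπ x₀
  -- J5b
  set D : ℝ := Real.exp (C_D * n' * (1 + Real.log n')) with hD_def
  have hdet : ∀ W : LGConfig 4 SU2, |(fpOperator H W).det| ≤ D := fun W => hDet H W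
  -- the two bounds of the assembly core
  have hup := orbitNormaliser_upper_J H hJ1 hβ ha₀ ha₀π V hF hcontr hfar hdet (r := r) (c₅ := c₅)
  have hlow := orbitNormaliser_lower_J H hJ1 hβ ha₀π ha₁a₀ V hF hcontr hcut hsurj hdet (ρ := ρ₄)
  -- rewrite `Z₀`
  set K : ℝ := ((2 * Real.pi ^ 2) ^ (interiorSites H).card)⁻¹ with hK_def
  set G : ℝ := Real.sqrt (Real.pi / β) ^ Fintype.card (↥(interiorSites H) × Fin 3) with hG_def
  have hK0 : 0 < K := by positivity
  have hG0 : 0 < G := by positivity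
  have hZ : laplaceZ0 β H = K * G := by rw [laplaceZ0_eq H hβ, hK_def, hG_def, card_prod_eq]
  have hZ0 : 0 < laplaceZ0 β H := by rw [hZ]; positivity
  set NJ := orbitAverage H (jacWeight β H r) V with hNJ_def
  -- lower exponential bound for `Z₀ = K·G`
  have hKexp : Real.exp (-(3 * n')) ≤ K := by
    rw [hK_def, Real.exp_neg]
    refine inv_anti₀ (by positivity) ?_
    have h1 : (2 * Real.pi ^ 2) ^ (interiorSites H).card ≤ Real.exp 3 ^ (interiorSites H).card :=
      pow_le_pow_left₀ (by positivity) two_pi_sq_le_exp_three _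
    have h2 : Real.exp 3 ^ (interiorSites H).card = Real.exp (3 * n') := by
      rw [← Real.exp_nat_mul, hn'_def]; ring_nf
    rw [← h2]; exact h1
  have hGexp : Real.exp (-(3 * n' / 2 * Real.log β)) ≤ G := by
    have h1 : Real.exp (-(Real.log β / 2)) ≤ Real.sqrt (Real.pi / β) := by
      have h2 : Real.sqrt (β⁻¹) = Real.exp (-(Real.log β / 2)) := by
        rw [Real.sqrt_eq_iff_mul_self_eq_of_pos (Real.exp_pos _), ← Real.exp_add,
          show -(Real.log β / 2) + -(Real.log β / 2) = -Real.log β by ring, Real.exp_neg, Real.exp_log hβ]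
      rw [← h2]
      refine Real.sqrt_le_sqrt ?_
      rw [div_eq_mul_inv]
      have : (1 : ℝ) * β⁻¹ ≤ Real.pi * β⁻¹ := mul_le_mul_of_nonneg_right (by linarith [Real.pi_gt_three]) (inv_nonneg.2 hβ.le)
      linarith
    have h3 : Real.exp (-(Real.log β / 2)) ^ Fintype.card (↥(interiorSites H) × Fin 3) ≤ G :=
      pow_le_pow_left₀ (Real.exp_pos _).le h1 _
    rw [← Real.exp_nat_mul, hN] at h3
    convert h3 using 2; ring
  have hZexp : Real.exp (-(3 * n') + -(3 * n' / 2 * Real.log β)) ≤ K * G := by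
    rw [Real.exp_add]; exact mul_le_mul hKexp hGexp (Real.exp_pos _).le hK0.le
  -- ARITH-B: the Gaussian ball deficit
  have hρ₄low : 1 / (2 * C₄ * (H : ℝ) ^ 4 * L ^ 4) ≤ ρ₄ := by
    rw [hρ₄_def, ha₁_def, div_div]
    refine one_div_le_one_div_of_le (by positivity) ?_
    have h1 : (1 + Real.log (H : ℝ)) ^ 2 ≤ L ^ 2 := pow_le_pow_left₀ (by linarith) hLH 2
    have h2 : 2 * (H : ℝ) ^ 4 * L ^ 2 * (C₄ * (1 + Real.log (H : ℝ)) ^ 2) ≤ 2 * (H : ℝ) ^ 4 * L ^ 2 * (C₄ * L ^ 2) :=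
      mul_le_mul_of_nonneg_left (mul_le_mul_of_nonneg_left h1 hC₄.le) (by positivity)
    calc 2 * (H : ℝ) ^ 4 * L ^ 2 * (C₄ * (1 + Real.log (H : ℝ)) ^ 2) ≤ 2 * (H : ℝ) ^ 4 * L ^ 2 * (C₄ * L ^ 2) := h2
      _ = 2 * C₄ * (H : ℝ) ^ 4 * L ^ 4 := by ring
  have hβρ : 200 * (H : ℝ) ^ 4 ≤ β * ρ₄ ^ 2 := by
    have h1 : (1 / (2 * C₄ * (H : ℝ) ^ 4 * L ^ 4)) ^ 2 ≤ ρ₄ ^ 2 := pow_le_pow_left₀ (by positivity) hρ₄low 2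
    have h2 : β * (1 / (2 * C₄ * (H : ℝ) ^ 4 * L ^ 4)) ^ 2 = β / (4 * C₄ ^ 2 * (H : ℝ) ^ 8 * L ^ 8) := by
      field_simp; ring
    have h3 : 200 * (H : ℝ) ^ 4 ≤ β / (4 * C₄ ^ 2 * (H : ℝ) ^ 8 * L ^ 8) := by
      rw [le_div_iff₀ (by positivity)]
      have h4 : 800 * C₄ ^ 2 * (H : ℝ) ^ 12 * L ^ 8 ≤ Cw * (H : ℝ) ^ 12 * L ^ 8 := by gcongr
      have h5 : 200 * (H : ℝ) ^ 4 * (4 * C₄ ^ 2 * (H : ℝ) ^ 8 * L ^ 8) = 800 * C₄ ^ 2 * (H : ℝ) ^ 12 * L ^ 8 := by ring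
      linarith
    calc 200 * (H : ℝ) ^ 4 ≤ β / (4 * C₄ ^ 2 * (H : ℝ) ^ 8 * L ^ 8) := h3
      _ = β * (1 / (2 * C₄ * (H : ℝ) ^ 4 * L ^ 4)) ^ 2 := h2.symm
      _ ≤ β * ρ₄ ^ 2 := mul_le_mul_of_nonneg_left h1 hβ.le
  have hN48 : (Fintype.card (↥(interiorSites H) × Fin 3) : ℝ) ≤ 48 * (H : ℝ) ^ 4 := by rw [hN]; linarith
  have hsqrt2N : Real.sqrt 2 ^ Fintype.card (↥(interiorSites H) × Fin 3) ≤
      Real.exp ((Fintype.card (↥(interiorSites H) × Fin 3) : ℝ) / 2) := by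
    have h1 := pow_le_pow_left₀ (Real.sqrt_nonneg 2) sqrt_two_le_exp_half (Fintype.card (↥(interiorSites H) × Fin 3))
    rw [← Real.exp_nat_mul, show ((Fintype.card (↥(interiorSites H) × Fin 3) : ℕ) : ℝ) * (1 / 2 : ℝ) =
      (Fintype.card (↥(interiorSites H) × Fin 3) : ℝ) / 2 by ring] at h1
    exact h1
  have hdef : Real.exp (-(β * ρ₄ ^ 2 / 2)) * Real.sqrt 2 ^ Fintype.card (↥(interiorSites H) × Fin 3) ≤
      Real.exp (-(1 * (H : ℝ) ^ 4)) := by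
    calc Real.exp (-(β * ρ₄ ^ 2 / 2)) * Real.sqrt 2 ^ Fintype.card (↥(interiorSites H) × Fin 3)
        ≤ Real.exp (-(β * ρ₄ ^ 2 / 2)) * Real.exp ((Fintype.card (↥(interiorSites H) × Fin 3) : ℝ) / 2) :=
          mul_le_mul_of_nonneg_left hsqrt2N (Real.exp_pos _).le
      _ = Real.exp (-(β * ρ₄ ^ 2 / 2) + (Fintype.card (↥(interiorSites H) × Fin 3) : ℝ) / 2) := (Real.exp_add _ _).symm
      _ ≤ Real.exp (-(1 * (H : ℝ) ^ 4)) := Real.exp_le_exp.2 (by linarith [hβρ, hN48, hH4])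
  -- ARITH-A: the far region against `Z₀`
  have hlogn : Real.log n' ≤ 3 + 4 * Real.log β := by
    have h1 : Real.log n' ≤ Real.log (16 * (H : ℝ) ^ 4) := Real.log_le_log (by linarith) hn16
    have h2 : Real.log (16 * (H : ℝ) ^ 4) = Real.log 16 + 4 * Real.log H := by
      rw [Real.log_mul (by norm_num) (by positivity), Real.log_pow]; push_cast; ring
    linarith [log_sixteen_le_three]
  have hfarexp : C_D * n' * (1 + Real.log n') + -(β * (c₅ * a₀ ^ 2 / (H : ℝ) ^ 4)) ≤
      -(1 * (H : ℝ) ^ 4) + (-(3 * n') + -(3 * n' / 2 * Real.log β)) := by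
    -- `βX ≥ (64 C_D + 74) H⁴ L`
    have hX : β * (c₅ * a₀ ^ 2 / (H : ℝ) ^ 4) = β * c₅ / (A₂ ^ 2 * (H : ℝ) ^ 8) := by
      rw [ha₀_def]; field_simp
    have hβX : (64 * C_D + 74) * (H : ℝ) ^ 4 * L ≤ β * (c₅ * a₀ ^ 2 / (H : ℝ) ^ 4) := by
      rw [hX, le_div_iff₀ (by positivity)]
      have h1 : Cfar * (H : ℝ) ^ 12 * L ^ 8 ≤ Cw * (H : ℝ) ^ 12 * L ^ 8 := by gcongr
      have h2 : Cfar * c₅ = A₂ ^ 2 * (64 * C_D + 74) := by rw [hCfar_def]; field_simp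
      have h3 : L ≤ L ^ 8 := le_self_pow₀ hL1 (by norm_num)
      have h4 : (64 * C_D + 74) * (H : ℝ) ^ 4 * L * (A₂ ^ 2 * (H : ℝ) ^ 8) = (Cfar * c₅) * (H : ℝ) ^ 12 * L := by
        rw [h2]; ring
      rw [h4]
      have h5 : Cfar * c₅ * (H : ℝ) ^ 12 * L ≤ Cfar * c₅ * (H : ℝ) ^ 12 * L ^ 8 := by
        have : 0 ≤ Cfar * c₅ * (H : ℝ) ^ 12 := by rw [h2]; positivity
        exact mul_le_mul_of_nonneg_left h3 this
      have h6 : Cfar * c₅ * (H : ℝ) ^ 12 * L ^ 8 = (Cfar * (H : ℝ) ^ 12 * L ^ 8) * c₅ := by ring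
      have h7 : (Cw * (H : ℝ) ^ 12 * L ^ 8) * c₅ ≤ β * c₅ := mul_le_mul_of_nonneg_right hwin hc₅.le
      have h1' := mul_le_mul_of_nonneg_right h1 hc₅.le
      linarith [h5, h6, h1', h7]
    -- the small terms
    have hT1 : C_D * n' * (1 + Real.log n') ≤ 64 * C_D * (H : ℝ) ^ 4 * L := by
      have h1 : 1 + Real.log n' ≤ 4 * L := by rw [hL_def]; linarith
      have h2 : 0 ≤ 1 + Real.log n' := by linarith [Real.log_nonneg hn1]
      calc C_D * n' * (1 + Real.log n') ≤ C_D * (16 * (H : ℝ) ^ 4) * (4 * L) := by gcongr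
        _ = 64 * C_D * (H : ℝ) ^ 4 * L := by ring
    have hHL : (H : ℝ) ^ 4 ≤ (H : ℝ) ^ 4 * L := le_mul_of_one_le_right (by positivity) hL1
    have hT2 : 3 * n' ≤ 48 * (H : ℝ) ^ 4 * L := by linarith
    have hT3 : 3 * n' / 2 * Real.log β ≤ 24 * (H : ℝ) ^ 4 * L := by
      have hl : Real.log β ≤ L := by rw [hL_def]; linarith
      have := mul_le_mul hn16 hl hlogβ.le (by positivity)
      linarith
    have hT4 : 1 * (H : ℝ) ^ 4 ≤ (H : ℝ) ^ 4 * L := by linarith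
    linarith [hβX, hT1, hT2, hT3, hT4]
  have hfar_le : D * Real.exp (-(β * (c₅ * a₀ ^ 2 / (H : ℝ) ^ 4))) ≤ Real.exp (-(1 * (H : ℝ) ^ 4)) * (K * G) := by
    calc D * Real.exp (-(β * (c₅ * a₀ ^ 2 / (H : ℝ) ^ 4)))
        = Real.exp (C_D * n' * (1 + Real.log n') + -(β * (c₅ * a₀ ^ 2 / (H : ℝ) ^ 4))) := by rw [hD_def, ← Real.exp_add]
      _ ≤ Real.exp (-(1 * (H : ℝ) ^ 4) + (-(3 * n') + -(3 * n' / 2 * Real.log β))) := Real.exp_le_exp.2 hfarexp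
      _ = Real.exp (-(1 * (H : ℝ) ^ 4)) * Real.exp (-(3 * n') + -(3 * n' / 2 * Real.log β)) := Real.exp_add _ _
      _ ≤ Real.exp (-(1 * (H : ℝ) ^ 4)) * (K * G) := mul_le_mul_of_nonneg_left hZexp (Real.exp_pos _).le
  -- conclude
  have hKG : 0 < K * G := mul_pos hK0 hG0
  rw [hZ, abs_sub_le_iff]
  constructor
  · -- upper
    rw [div_sub_one hKG.ne', div_le_iff₀ hKG]
    linarith [hup, hfar_le]
  · -- lower
    rw [one_sub_div hKG.ne', div_le_iff₀ hKG]
    have h1 : K * (G - Real.exp (-(β * ρ₄ ^ 2 / 2)) * Real.sqrt (2 * Real.pi / β) ^ Fintype.card (↥(interiorSites H) × Fin 3)) ≤ NJ := hlow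
    rw [sqrt_two_pi_div_pow] at h1
    have h2 : K * (Real.exp (-(β * ρ₄ ^ 2 / 2)) * (Real.sqrt 2 ^ Fintype.card (↥(interiorSites H) × Fin 3) * G)) ≤
        K * (Real.exp (-(1 * (H : ℝ) ^ 4)) * G) := by
      refine mul_le_mul_of_nonneg_left ?_ hK0.le
      calc Real.exp (-(β * ρ₄ ^ 2 / 2)) * (Real.sqrt 2 ^ Fintype.card (↥(interiorSites H) × Fin 3) * G)
          = (Real.exp (-(β * ρ₄ ^ 2 / 2)) * Real.sqrt 2 ^ Fintype.card (↥(interiorSites H) × Fin 3)) * G := by ring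
        _ ≤ Real.exp (-(1 * (H : ℝ) ^ 4)) * G := mul_le_mul_of_nonneg_right hdef hG0.le
    linarith [h1, h2]

end Summit.QuantumFields.YangMills.Theorems.AllWindowsColdBoxBoxHighLine.OrbitJacobian

end
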